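import Mathlib
import HarnessLib
import Summits.HubbardSuperconductivity.HubbardSuperconductivity.Theorems.KLProgrammeKLRegimeEnginePairLadderTowerComposeSet
import Summits.HubbardSuperconductivity.HubbardSuperconductivity.Theorems.KLProgrammeKLRegimeEnginePairLadderDuhamel

/-!
# Route `KLProgramme` — crux K3 ENGINE (stmt-HubbardSuperconductivity-20437 `KLRegimeEngineV17F2`), row (c) `stub_engine_step_values`, binder #8 `hexLadPkg`:
# the single-member RESOLVENT TOWER, RE-CENTRED at the history member — `kltc_tower_recentred`
# (cell gate-hubbard-kl, seat hubbard-kl-k3c1-p1 g24, technique «composed-map remainder propagation»; item «ROW-(c)-HTOWER-BY-TYPE»)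

WHY.  Row (c)'s in-class ladder row `hexLad` is consumed through `EngineV8.pairLadderStepAtV17F2_of_relFamilyK5_klCT8` (…V8PairTransferExport8 §4),
whose TOWER package `htower` asks, per pair class, for a Neumann inverse `Nm` of `1 + diag w₁·X` AT THE HISTORY MEMBER `X` (frame `Kₙ₋₁`) together with an
error row `‖C₁(k,k′) − (X·Nm)(k,k′)‖ ≤ Ea(k,k′)` on the bare ball for the scale-`n` array `C₁`.  The lineage's weighted Duhamel comparison
`kltc_riccati_duhamel_weighted` (…PairLadderDuhamel) produces such a pair `(N, error)` for a within-slice flow `Γ` — but centred at the flow's own start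
`Γ(0)` (frame `Kₙ`), not at `X`.  This file closes the gap ONCE, generically: the start row `‖Γ(0) − X‖ ≤ R′` is propagated through the resummation map by
the forward composition `kltc_compose_fwd_on` (…TowerComposeSet) with ZERO straddle weights (`b′ = b = 0`, `M′ = M₀ = 1`), i.e. the re-centring
`F_{w₁}(Γ(0)) ↦ F_{w₁}(X)` costs exactly the four-term dressing `FT_{|w₁|}(R′)` — «composed-map remainder propagation».

* `kltc_exists_sum_norm_rate_le` — a continuous rate on `[0,1]` has a uniform `ℓ¹` bound (the `β` binder of the Duhamel door, discharged);
* `kltc_tail_le_of_integral_rate` — cumulative-rung tails are below the INTEGRATED RATE PROFILE `∫₀¹‖ḃ(τ,a)‖dτ ≤ ρ_a` (the resolved currency of record,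
  `…RelativeFlowRates`);
* **`kltc_tower_recentred`** — inputs on `[0,1]`: entrywise-C¹ `Γ` with `Γ̇ = −Γ·diag ḃ·Γ + S` written as `S = Γ̇ + Γ·diag ḃ·Γ`, cumulative rung `b` with
  REAL total `b(1) − b(0) = w₁`, a priori `|Γ(t)|, |X| ≤ m`, integrated rate profile `ρ` with `(3/2)m·Σρ ≤ 1/3`, endpoint `Γ(1) = C₁`, start row
  `‖Γ(0) − X‖ ≤ R′ ≤ r′` on `B²` (all four arrays vanish off `B²`), smallness `(3/2·m + r′)·Σ|w₁| ≤ 1/3`, a source-integral majorant `I ≥ ∫₀¹‖S‖`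
  and ONE majorant row `E ≥ FT_ρ(I) + FT_{|w₁|}(R′)`.  Output: `∃ Nm`, two-sided inverse of `1 + diag w₁·X`, with `‖C₁(k,k′) − (X·Nm)(k,k′)‖ ≤ E(k,k′)` on `B²`
  — the (`X`, `Nm`, `w₁`, `Ea := E`) quadruple of `htower`.
Real analysis + exact algebra over landed doors; nothing about the model is asserted; nothing asserts (c), any stub of 20437, K3 or superconductivity.  0 kit · 0 lit.
-/

noncomputable section

namespace Summit.HubbardSuperconductivity.HubbardSuperconductivity.Theorems.KLRegimeSplit

set_option linter.dupNamespace false -- summit = problem name (single-conjunct summit), D-0017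

open Finset Matrix Set
open Summit.HubbardSuperconductivity.HubbardSuperconductivity.Theorems.KLProgrammeCooperResummation

section Generic

variable {ι : Type*} [Fintype ι] [DecidableEq ι] [Nonempty ι]

omit [DecidableEq ι] [Nonempty ι] in
/-- A rate that is entrywise continuous on `[0,1]` has a uniform `ℓ¹` bound there (compactness). -/
theorem kltc_exists_sum_norm_rate_le (b' : ℝ → ι → ℂ) (hb'c : ∀ a, ContinuousOn (fun t => b' t a) (Icc 0 1)) :
    ∃ βr : ℝ, ∀ t ∈ Icc (0 : ℝ) 1, ∑ a, ‖b' t a‖ ≤ βr := by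
  have hc : ContinuousOn (fun t => ∑ a, ‖b' t a‖) (Icc 0 1) :=
    continuousOn_finsetSum _ fun a _ => (hb'c a).norm
  obtain ⟨βr, hβr⟩ := isCompact_Icc.bddAbove_image hc
  exact ⟨βr, fun t ht => hβr (Set.mem_image_of_mem _ ht)⟩

omit [Fintype ι] [DecidableEq ι] [Nonempty ι] in
/-- **Tails below the integrated rate profile**: for a cumulative rung `b` with entrywise derivative `ḃ` on `[0,1]` (continuous there) and
`∫₀¹‖ḃ(τ,a)‖dτ ≤ ρ_a`, every tail obeys `‖b(1,a) − b(t,a)‖ ≤ ρ_a`, `t ∈ [0,1]`. -/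
theorem kltc_tail_le_of_integral_rate (b b' : ℝ → ι → ℂ) (ρ : ι → ℝ)
    (hb : ∀ t ∈ Icc (0 : ℝ) 1, ∀ a, HasDerivAt (fun s => b s a) (b' t a) t)
    (hb'c : ∀ a, ContinuousOn (fun t => b' t a) (Icc 0 1))
    (hρ : ∀ a, (∫ τ in (0 : ℝ)..1, ‖b' τ a‖) ≤ ρ a) :
    ∀ t ∈ Icc (0 : ℝ) 1, ∀ a, ‖b 1 a - b t a‖ ≤ ρ a := by
  intro t ht a
  have hsub : Set.uIcc t 1 ⊆ Icc 0 1 := by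
    rw [Set.uIcc_of_le ht.2]; exact Set.Icc_subset_Icc_left ht.1
  have hderiv : ∀ s ∈ Set.uIcc t 1, HasDerivAt (fun s => b s a) (b' s a) s := fun s hs => hb s (hsub hs) a
  have hint : IntervalIntegrable (fun s => b' s a) MeasureTheory.volume t 1 :=
    ((hb'c a).mono hsub).intervalIntegrable
  have hint01 : IntervalIntegrable (fun s => b' s a) MeasureTheory.volume 0 1 :=
    ((hb'c a).mono (by rw [Set.uIcc_of_le zero_le_one])).intervalIntegrable
  have hftc : ∫ s in t..1, b' s a = b 1 a - b t a := intervalIntegral.integral_eq_sub_of_hasDerivAt hderiv hint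
  rw [← hftc]
  calc ‖∫ s in t..1, b' s a‖ ≤ ∫ s in t..1, ‖b' s a‖ := intervalIntegral.norm_integral_le_integral_norm ht.2
    _ ≤ ∫ s in (0 : ℝ)..1, ‖b' s a‖ :=
        intervalIntegral.integral_mono_interval ht.1 ht.2 le_rfl (Filter.Eventually.of_forall fun s => norm_nonneg _) hint01.norm
    _ ≤ ρ a := hρ a

set_option maxHeartbeats 800000 in -- long binder lists; plumbing into `kltc_riccati_duhamel_weighted` + `kltc_compose_fwd_on`
/-- **The single-member resolvent tower, re-centred at the history member.**  See the module docstring.  All hypotheses on `[0,1]`; `B` the truncation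
set; `X` the history member array, `C₁` the target array, `Γ` the member flow with `Γ 1 = C₁`; `w₁ = b 1 − b 0` REAL. -/
theorem kltc_tower_recentred (B : Finset ι) (X C₁ : Matrix ι ι ℂ) (Γ Γ' S : ℝ → Matrix ι ι ℂ) (b b' : ℝ → ι → ℂ) (w₁ : ι → ℝ)
    (ρ : ι → ℝ) (R' I E : ι → ι → ℝ) {m r' : ℝ} (hm : 0 ≤ m) (hr' : 0 ≤ r')
    (hX0 : ∀ x y, ¬(x ∈ B ∧ y ∈ B) → X x y = 0) (hC₁0 : ∀ x y, ¬(x ∈ B ∧ y ∈ B) → C₁ x y = 0)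
    (hΓ00 : ∀ x y, ¬(x ∈ B ∧ y ∈ B) → Γ 0 x y = 0) (hΓ1 : Γ 1 = C₁)
    (hΓ : ∀ t ∈ Icc (0 : ℝ) 1, ∀ x y, HasDerivAt (fun s => Γ s x y) (Γ' t x y) t)
    (hb : ∀ t ∈ Icc (0 : ℝ) 1, ∀ a, HasDerivAt (fun s => b s a) (b' t a) t)
    (hΓ'c : ∀ x y, ContinuousOn (fun t => Γ' t x y) (Icc 0 1)) (hb'c : ∀ a, ContinuousOn (fun t => b' t a) (Icc 0 1))
    (hS : ∀ t ∈ Icc (0 : ℝ) 1, S t = Γ' t + Γ t * diagonal (b' t) * Γ t)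
    (hΓm : ∀ t ∈ Icc (0 : ℝ) 1, ∀ x y, ‖Γ t x y‖ ≤ m) (hXm : ∀ x y, ‖X x y‖ ≤ m)
    (hρ : ∀ a, (∫ τ in (0 : ℝ)..1, ‖b' τ a‖) ≤ ρ a) (hsm : 3 / 2 * m * ∑ a, ρ a ≤ 1 / 3)
    (hw₁ : ∀ p, b 1 p - b 0 p = (w₁ p : ℂ))
    (hR'0 : ∀ x y, 0 ≤ R' x y) (hR' : ∀ k ∈ B, ∀ k' ∈ B, ‖Γ 0 k k' - X k k'‖ ≤ R' k k') (hR'e : ∀ x y, R' x y ≤ r')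
    (hsm₁ : (3 / 2 * m + r') * ∑ a, |w₁ a| ≤ 1 / 3)
    (hI : ∀ x y, (∫ t in (0 : ℝ)..1, ‖S t x y‖) ≤ I x y)
    (hE : ∀ x y,
      (I x y + 3 / 2 * (3 / 2 * m) * ∑ c, I x c * ρ c + 3 / 2 * m * ∑ a, ρ a * I a y +
          9 / 4 * m * (3 / 2 * m) * ∑ a, ∑ c, ρ a * I a c * ρ c) +
        (R' x y + 3 / 2 * (3 / 2 * m) * ∑ t, R' x t * |w₁ t| + 3 / 2 * (3 / 2 * m + r') * ∑ a, |w₁ a| * R' a y +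
          9 / 4 * (3 / 2 * m + r') * (3 / 2 * m) * ∑ a, ∑ t, |w₁ a| * R' a t * |w₁ t|) ≤ E x y) :
    ∃ Nm : Matrix ι ι ℂ,
      (1 + diagonal (fun p => (w₁ p : ℂ)) * X) * Nm = 1 ∧ Nm * (1 + diagonal (fun p => (w₁ p : ℂ)) * X) = 1 ∧
      ∀ k ∈ B, ∀ k' ∈ B, ‖C₁ k k' - (X * Nm) k k'‖ ≤ E k k' := by
  have h01 : (0 : ℝ) ∈ Icc (0 : ℝ) 1 := ⟨le_rfl, zero_le_one⟩
  have h11 : (1 : ℝ) ∈ Icc (0 : ℝ) 1 := ⟨zero_le_one, le_rfl⟩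
  -- nonnegativity bookkeeping
  have hρ0 : ∀ a, 0 ≤ ρ a := fun a =>
    (intervalIntegral.integral_nonneg zero_le_one fun τ _ => norm_nonneg _).trans (hρ a)
  have hI0 : ∀ x y, 0 ≤ I x y := fun x y =>
    (intervalIntegral.integral_nonneg zero_le_one fun t _ => norm_nonneg _).trans (hI x y)
  -- the Duhamel door's rate binder, discharged by compactness; its tail binder, by the integrated profile
  obtain ⟨βr, hβr⟩ := kltc_exists_sum_norm_rate_le b' hb'c
  have htail := kltc_tail_le_of_integral_rate b b' ρ hb hb'c hρ
  -- (1) the weighted Duhamel comparison, centred at `Γ 0`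
  obtain ⟨N, hN1, hN2, herr⟩ := kltc_riccati_duhamel_weighted Γ Γ' S b b' ρ hm hΓ hb hΓ'c hb'c hS hΓm hβr htail hsm
  have hdiag : diagonal (b 1 - b 0) = diagonal (fun p => (w₁ p : ℂ)) := by
    congr 1; funext p; rw [Pi.sub_apply, hw₁ p]
  rw [hdiag] at hN1 hN2
  -- the source integral through its majorant `I` (four-term form is monotone)
  set FTI : ι → ι → ℝ := fun x y => I x y + 3 / 2 * (3 / 2 * m) * ∑ c, I x c * ρ c + 3 / 2 * m * ∑ a, ρ a * I a y +
      9 / 4 * m * (3 / 2 * m) * ∑ a, ∑ c, ρ a * I a c * ρ c with hFTI_def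
  have hFTI0 : ∀ x y, 0 ≤ FTI x y := fun x y => by
    simp only [hFTI_def]
    have h2 : 0 ≤ ∑ c, I x c * ρ c := sum_nonneg fun c _ => mul_nonneg (hI0 x c) (hρ0 c)
    have h3 : 0 ≤ ∑ a, ρ a * I a y := sum_nonneg fun a _ => mul_nonneg (hρ0 a) (hI0 a y)
    have h4 : 0 ≤ ∑ a, ∑ c, ρ a * I a c * ρ c := sum_nonneg fun a _ => sum_nonneg fun c _ =>
      mul_nonneg (mul_nonneg (hρ0 a) (hI0 a c)) (hρ0 c)
    have h1 := hI0 x y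
    positivity
  have hEa : ∀ k ∈ B, ∀ k' ∈ B, ‖Γ 1 k k' - (Γ 0 * N) k k'‖ ≤ FTI k k' := by
    intro k _ k' _
    refine (herr k k').trans ?_
    simp only [hFTI_def]
    have hm' : 0 ≤ 3 / 2 * m := by positivity
    have t1 := hI k k'
    have t2 : ∑ c, (∫ t in (0 : ℝ)..1, ‖S t k c‖) * ρ c ≤ ∑ c, I k c * ρ c :=
      sum_le_sum fun c _ => mul_le_mul_of_nonneg_right (hI k c) (hρ0 c)
    have t3 : ∑ a, ρ a * (∫ t in (0 : ℝ)..1, ‖S t a k'‖) ≤ ∑ a, ρ a * I a k' :=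
      sum_le_sum fun a _ => mul_le_mul_of_nonneg_left (hI a k') (hρ0 a)
    have t4 : ∑ a, ∑ c, ρ a * (∫ t in (0 : ℝ)..1, ‖S t a c‖) * ρ c ≤ ∑ a, ∑ c, ρ a * I a c * ρ c :=
      sum_le_sum fun a _ => sum_le_sum fun c _ =>
        mul_le_mul_of_nonneg_right (mul_le_mul_of_nonneg_left (hI a c) (hρ0 a)) (hρ0 c)
    have c2 : 0 ≤ 3 / 2 * (3 / 2 * m) := by positivity
    have c4 : 0 ≤ 9 / 4 * m * (3 / 2 * m) := by positivity
    have := mul_le_mul_of_nonneg_left t2 c2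
    have := mul_le_mul_of_nonneg_left t3 hm'
    have := mul_le_mul_of_nonneg_left t4 c4
    linarith
  -- (2) re-centring at `X` by the forward composition with ZERO straddle weights
  have hE0 : ∀ x y, 0 ≤ E x y := by
    intro x y
    refine le_trans ?_ (hE x y)
    have hw0 : ∀ a, 0 ≤ |w₁ a| := fun a => abs_nonneg _
    have h2 : 0 ≤ ∑ t, R' x t * |w₁ t| := sum_nonneg fun t _ => mul_nonneg (hR'0 x t) (hw0 t)
    have h3 : 0 ≤ ∑ a, |w₁ a| * R' a y := sum_nonneg fun a _ => mul_nonneg (hw0 a) (hR'0 a y)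
    have h4 : 0 ≤ ∑ a, ∑ t, |w₁ a| * R' a t * |w₁ t| := sum_nonneg fun a _ => sum_nonneg fun t _ =>
      mul_nonneg (mul_nonneg (hw0 a) (hR'0 a t)) (hw0 t)
    have := hFTI0 x y
    have := hR'0 x y
    positivity
  set e₁ : ℝ := ∑ x, ∑ y, E x y with he₁_def
  have he₁ : 0 ≤ e₁ := sum_nonneg fun x _ => sum_nonneg fun y _ => hE0 x y
  have hEe : ∀ x y, E x y ≤ e₁ := fun x y => by
    rw [he₁_def]
    exact (single_le_sum (f := fun y => E x y) (fun y _ => hE0 x y) (mem_univ y)).trans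
      (single_le_sum (f := fun x => ∑ y, E x y) (fun x _ => sum_nonneg fun y _ => hE0 x y) (mem_univ x))
  have hd0 : (diagonal fun _ : ι => (((0 : ℝ) : ℝ) : ℂ)) = 0 := by
    rw [Complex.ofReal_zero]; exact diagonal_zero
  have hM' : (1 - diagonal (fun p : ι => (((fun _ => (0 : ℝ)) p : ℝ) : ℂ)) * X) * (1 : Matrix ι ι ℂ) = 1 := by
    rw [Matrix.mul_one, show (fun p : ι => (((fun _ => (0 : ℝ)) p : ℝ) : ℂ)) = fun _ => (((0 : ℝ) : ℝ) : ℂ) from rfl, hd0,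
      Matrix.zero_mul, sub_zero]
  have hM₀ : (1 - diagonal (fun p : ι => (((fun _ => (0 : ℝ)) p : ℝ) : ℂ)) * C₁) * (1 : Matrix ι ι ℂ) = 1 := by
    rw [Matrix.mul_one, show (fun p : ι => (((fun _ => (0 : ℝ)) p : ℝ) : ℂ)) = fun _ => (((0 : ℝ) : ℝ) : ℂ) from rfl, hd0,
      Matrix.zero_mul, sub_zero]
  have hY0 : ∀ x y, ¬(x ∈ B ∧ y ∈ B) → Γ 1 x y = 0 := fun x y hxy => by rw [hΓ1]; exact hC₁0 x y hxy
  have hR'1 : ∀ k ∈ B, ∀ k' ∈ B, ‖Γ 0 k k' - (X * (1 : Matrix ι ι ℂ)) k k'‖ ≤ R' k k' := fun k hk k' hk' => by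
    rw [Matrix.mul_one]; exact hR' k hk k' hk'
  have hER : ∀ k ∈ B, ∀ k' ∈ B, ‖Γ 1 k k' - (C₁ * (1 : Matrix ι ι ℂ)) k k'‖ ≤ (fun _ _ : ι => (0 : ℝ)) k k' := fun k _ k' _ => by
    rw [Matrix.mul_one, hΓ1, sub_self, norm_zero]
  have hsum0 : ∑ a : ι, |(fun _ : ι => (0 : ℝ)) a| = 0 := by simp
  obtain ⟨N₃, h₃1, h₃2, herr₃⟩ := kltc_compose_fwd_on B X C₁ (Γ 0) (Γ 1) 1 N 1 (fun _ => (0 : ℝ)) w₁ (fun _ => (0 : ℝ))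
    R' FTI (fun _ _ => (0 : ℝ)) E E (m := m) (r' := r') (eR := 0) (e₁ := e₁) hm hr' le_rfl he₁ hXm hX0 hC₁0 hΓ00 hY0
    hR'0 (fun x y => hFTI0 x y) (fun _ _ => le_rfl) hM' hR'1 hR'e hN1 hEa hM₀ hER (fun _ _ => le_rfl)
    (fun x y => by simpa only [hFTI_def] using hE x y) hEe (fun x y => by simp)
    (by rw [hsum0, mul_zero]; norm_num) hsm₁ (by rw [hsum0, mul_zero]; norm_num)
  have hfun : (fun p : ι => ((w₁ p + (fun _ : ι => (0 : ℝ)) p - (fun _ : ι => (0 : ℝ)) p : ℝ) : ℂ)) = fun p => (w₁ p : ℂ) := by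
    funext p; simp
  rw [hfun] at h₃1 h₃2
  refine ⟨N₃, h₃1, h₃2, fun k hk k' hk' => ?_⟩
  have h := herr₃ k hk k' hk'
  simpa only [abs_zero, mul_zero, zero_mul, sum_const_zero, add_zero] using h

end Generic

end Summit.HubbardSuperconductivity.HubbardSuperconductivity.Theorems.KLRegimeSplit

end
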